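import Summits.HubbardSuperconductivity.HubbardSuperconductivity.Theorems.BirComplexStableXY.Negative.BirComplexStableXYFalseOfWitnessZeroExists

/-!
# Gauge reduction of the witness partition function to a twisted complex-stiffness XY model
(`BalabanIR.BirComplexStableXY`, stmt-HubbardSuperconductivity-2080, line `theta-rotor-equimodular-zeros`, S2a-ii)

For the witness table `witness ε₁ ε₂` of the negative lane (`Theorems/BirComplexStableXY/Negative/`)
the summed window action on the space-time torus `Λ L M = (ℤ/L)² × ℤ/M` is the nearest-neighbour
anisotropic XY action (every cube-edge direction occurs four times in the `2 × 2 × 2` window)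
`A(θ) = 4K Σ_s [(1 − cos ∂₁θ) + (1 − cos ∂₂θ) + (1 + iε₁)(1 − cos ∂_τθ) + iε₂ sin ∂_τθ](s)`
(`gaugeTwist_action_witness`).  GAUGE ALGEBRA (STEP 1): for any complex `R, ψ` with
`R cos ψ = a := 1 + iε₁` and `R sin ψ = b := iε₂`, pointwise `a(1 − cos v) + b sin v = a − R cos(v + ψ)`
(`Complex.cos_add`), so `e^{-A}` is the restriction to real configurations of the entire, coordinatewise
`2π`-periodic function
`G(z) = exp(−4K Σ_s [(1 − cos(z(s+e₁) − z(s))) + (1 − cos(z(s+e₂) − z(s))) + a − R cos(z(s+e_τ) − z(s) + ψ)])`.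
CONTOUR SHIFT (STEP 2, the hypothesis of the registered signature = stub S2a-i): the cube integral of
`G` is invariant under the complex translation `c(x, τ) = −τ.val • ψ`; across a temporal bond
`τ → τ + 1` this translation changes by `−ψ`, except across the wrap bond `M − 1 → 0` where it changes by
`(M − 1)ψ` (`gaugeTwist_shift_step`), so `G(θ + c)` is the Boltzmann weight of the complex-stiffness XY
model whose per-bond twist `ψ` has been moved entirely onto the wrap bonds, which carry the total twist
`Mψ`.  Hence `Z = partZ K (witness ε₁ ε₂) L M = ∫_cube G(θ) dθ = ∫_cube G(θ + c) dθ` is the twisted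
partition function of the registered signature (`stub_partZ_witness_gauge_of_shift`), for every `L, M ≥ 1`.
No definitions, no hypotheses beyond the registered signature.
-/

namespace Summit.HubbardSuperconductivity.BirComplexStableXYNegative

open scoped BigOperators
open MeasureTheory Literature.Probability.LatticeModels

noncomputable section

/-! ### The summed witness action is a nearest-neighbour anisotropic XY action -/

-- adapted from Cruxes/BirComplexStableXY/Disproof.lean §3d (`genF_witness_eq`, defs `S4dir1` … `T4sin` inlined)
/-- the witness generating function in closed form: the four dir-1 spatial edges, the four dir-2 spatial
edges, `(1 + iε₁)` times the four temporal `1 − cos` terms and `iε₂` times the four temporal `sin` terms. -/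
theorem gaugeTwist_genF_witness (ε₁ ε₂ : ℝ) (φ : W 2 → ℝ) :
    genF (witness ε₁ ε₂) φ =
      (((1 - Real.cos (φ (1, 0, 0) - φ (0, 0, 0))) + (1 - Real.cos (φ (1, 0, 1) - φ (0, 0, 1))) +
          (1 - Real.cos (φ (1, 1, 0) - φ (0, 1, 0))) + (1 - Real.cos (φ (1, 1, 1) - φ (0, 1, 1))) : ℝ) : ℂ)
      + (((1 - Real.cos (φ (0, 1, 0) - φ (0, 0, 0))) + (1 - Real.cos (φ (0, 1, 1) - φ (0, 0, 1))) +
          (1 - Real.cos (φ (1, 1, 0) - φ (1, 0, 0))) + (1 - Real.cos (φ (1, 1, 1) - φ (1, 0, 1))) : ℝ) : ℂ)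
      + ((1 : ℂ) + Complex.I * ε₁) *
        (((1 - Real.cos (φ (0, 0, 1) - φ (0, 0, 0))) + (1 - Real.cos (φ (0, 1, 1) - φ (0, 1, 0))) +
          (1 - Real.cos (φ (1, 0, 1) - φ (1, 0, 0))) + (1 - Real.cos (φ (1, 1, 1) - φ (1, 1, 0))) : ℝ) : ℂ)
      + (Complex.I * ε₂) *
        ((Real.sin (φ (0, 0, 1) - φ (0, 0, 0)) + Real.sin (φ (0, 1, 1) - φ (0, 1, 0)) +
          Real.sin (φ (1, 0, 1) - φ (1, 0, 0)) + Real.sin (φ (1, 1, 1) - φ (1, 1, 0)) : ℝ) : ℂ) := by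
  simp only [witness, spatialTab, temporalCosTab, temporalSinTab, spatialEdges, temporalEdges,
    List.map_cons, List.map_nil, List.sum_cons, List.sum_nil, genF_add, genF_smul,
    genF_cosTab, genF_sinTab, vx, add_zero]
  push_cast
  ring

section lattice
variable (L M : ℕ) [NeZero L] [NeZero M]

-- adapted from Cruxes/BirComplexStableXY/Disproof.lean §3d (`sum_shift`)
/-- translation invariance of lattice sums on the torus `Λ L M`. -/
theorem gaugeTwist_sum_shift (off : Λ L M) (g : Λ L M → ℂ) : ∑ s, g (s + off) = ∑ s, g s :=
  Equiv.sum_comp (Equiv.addRight off) g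

-- adapted from Cruxes/BirComplexStableXY/Disproof.lean §3d (`sum_edge_dir1`)
/-- translation invariance of the window sum, dir-1 spatial edges. -/
theorem gaugeTwist_sum_edge_dir1 (b t : Fin 2) (f : ℝ → ℂ) (θ : Λ L M → ℝ) :
    ∑ s : Λ L M, f (θ (sh L M s (vx 1 b t)) - θ (sh L M s (vx 0 b t))) =
      ∑ s : Λ L M, f (θ (s.1 + ![1, 0], s.2) - θ s) := by
  rw [← gaugeTwist_sum_shift L M ((![0, ((b : ℕ) : ZMod L)], ((t : ℕ) : ZMod M)) : Λ L M)
    (fun s => f (θ (s.1 + ![1, 0], s.2) - θ s))]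
  refine Finset.sum_congr rfl fun s _ => ?_
  congr 3
  · refine Prod.ext ?_ ?_
    · ext i; fin_cases i <;> simp [sh, Matrix.vecHead, Matrix.vecTail]
    · simp [sh]
  · refine Prod.ext ?_ ?_
    · ext i; fin_cases i <;> simp [sh, Matrix.vecHead, Matrix.vecTail]
    · simp [sh]

-- adapted from Cruxes/BirComplexStableXY/Disproof.lean §3d (`sum_edge_dir2`)
/-- translation invariance of the window sum, dir-2 spatial edges. -/
theorem gaugeTwist_sum_edge_dir2 (a t : Fin 2) (f : ℝ → ℂ) (θ : Λ L M → ℝ) :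
    ∑ s : Λ L M, f (θ (sh L M s (vx a 1 t)) - θ (sh L M s (vx a 0 t))) =
      ∑ s : Λ L M, f (θ (s.1 + ![0, 1], s.2) - θ s) := by
  rw [← gaugeTwist_sum_shift L M ((![((a : ℕ) : ZMod L), 0], ((t : ℕ) : ZMod M)) : Λ L M)
    (fun s => f (θ (s.1 + ![0, 1], s.2) - θ s))]
  refine Finset.sum_congr rfl fun s _ => ?_
  congr 3
  · refine Prod.ext ?_ ?_
    · ext i; fin_cases i <;> simp [sh, Matrix.vecHead, Matrix.vecTail]
    · simp [sh]
  · refine Prod.ext ?_ ?_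
    · ext i; fin_cases i <;> simp [sh, Matrix.vecHead, Matrix.vecTail]
    · simp [sh]

-- adapted from Cruxes/BirComplexStableXY/Disproof.lean §3d (`sum_edge_time`)
/-- translation invariance of the window sum, temporal edges. -/
theorem gaugeTwist_sum_edge_time (a b : Fin 2) (f : ℝ → ℂ) (θ : Λ L M → ℝ) :
    ∑ s : Λ L M, f (θ (sh L M s (vx a b 1)) - θ (sh L M s (vx a b 0))) =
      ∑ s : Λ L M, f (θ (s.1, s.2 + 1) - θ s) := by
  rw [← gaugeTwist_sum_shift L M ((![((a : ℕ) : ZMod L), ((b : ℕ) : ZMod L)], (0 : ZMod M)) : Λ L M)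
    (fun s => f (θ (s.1, s.2 + 1) - θ s))]
  refine Finset.sum_congr rfl fun s _ => ?_
  congr 3
  · refine Prod.ext ?_ ?_
    · ext i; fin_cases i <;> simp [sh, Matrix.vecHead, Matrix.vecTail]
    · simp [sh]
  · refine Prod.ext ?_ ?_
    · ext i; fin_cases i <;> simp [sh, Matrix.vecHead, Matrix.vecTail]
    · simp [sh]

-- adapted from Cruxes/BirComplexStableXY/Disproof.lean §3d (`action_witness`)
/-- THE SUMMED ACTION OF THE WITNESS = 4 × nearest-neighbour anisotropic XY with complex temporal
stiffness `1 + iε₁` and Berry-like term `iε₂ sin ∂_τθ`. -/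
theorem gaugeTwist_action_witness (ε₁ ε₂ K : ℝ) (θ : Λ L M → ℝ) :
    action K (witness ε₁ ε₂) L M θ = 4 * (K : ℂ) * ∑ s : Λ L M,
      ( (((1 - Real.cos (θ (s.1 + ![1, 0], s.2) - θ s) : ℝ)) : ℂ)
      + (((1 - Real.cos (θ (s.1 + ![0, 1], s.2) - θ s) : ℝ)) : ℂ)
      + ((1 : ℂ) + Complex.I * ε₁) * (((1 - Real.cos (θ (s.1, s.2 + 1) - θ s) : ℝ)) : ℂ)
      + (Complex.I * ε₂) * ((Real.sin (θ (s.1, s.2 + 1) - θ s) : ℝ) : ℂ) ) := by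
  unfold action
  simp_rw [gaugeTwist_genF_witness]
  simp only [Complex.ofReal_add, Finset.sum_add_distrib, Finset.mul_sum, mul_add, add_mul]
  have d1 := fun (b t : Fin 2) =>
    gaugeTwist_sum_edge_dir1 L M b t (fun x => (((1 - Real.cos x : ℝ)) : ℂ)) θ
  have d2 := fun (a t : Fin 2) =>
    gaugeTwist_sum_edge_dir2 L M a t (fun x => (((1 - Real.cos x : ℝ)) : ℂ)) θ
  have dc := fun (a b : Fin 2) =>
    gaugeTwist_sum_edge_time L M a b (fun x => (((1 - Real.cos x : ℝ)) : ℂ)) θ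
  have ds := fun (a b : Fin 2) =>
    gaugeTwist_sum_edge_time L M a b (fun x => ((Real.sin x : ℝ) : ℂ)) θ
  simp only [vx] at d1 d2 dc ds
  -- pull the constant factors out of the temporal sums, then use translation invariance
  simp only [← Finset.mul_sum]
  rw [d1 0 0, d1 0 1, d1 1 0, d1 1 1, d2 0 0, d2 0 1, d2 1 0, d2 1 1, dc 0 0, dc 0 1, dc 1 0, dc 1 1,
    ds 0 0, ds 0 1, ds 1 0, ds 1 1]
  simp only [Finset.mul_sum, ← Finset.sum_add_distrib]
  refine Finset.sum_congr rfl fun s _ => ?_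
  ring

end lattice

/-! ### STEP 1: the pointwise gauge algebra -/

/-- STEP 1, per site: with `R cos ψ = 1 + iε₁` and `R sin ψ = iε₂`,
`(1 + iε₁)(1 − cos v) + iε₂ sin v = (1 + iε₁) − R cos(v + ψ)` (`Complex.cos_add`), written for the four
terms of one site of the summed witness action, real configuration cast to `ℂ`. -/
theorem gaugeTwist_site_gauge (x₁ x₂ xt x₀ ε₁ ε₂ : ℝ) (R ψ : ℂ)
    (hR : R * Complex.cos ψ = 1 + Complex.I * ε₁) (hψ : R * Complex.sin ψ = Complex.I * ε₂) :
    (((1 - Real.cos (x₁ - x₀) : ℝ)) : ℂ) + (((1 - Real.cos (x₂ - x₀) : ℝ)) : ℂ)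
      + ((1 : ℂ) + Complex.I * ε₁) * (((1 - Real.cos (xt - x₀) : ℝ)) : ℂ)
      + (Complex.I * ε₂) * ((Real.sin (xt - x₀) : ℝ) : ℂ)
    = (1 - Complex.cos ((x₁ : ℂ) - (x₀ : ℂ))) + (1 - Complex.cos ((x₂ : ℂ) - (x₀ : ℂ)))
      + ((1 : ℂ) + Complex.I * ε₁) - R * Complex.cos ((xt : ℂ) - (x₀ : ℂ) + ψ) := by
  rw [Complex.cos_add]
  push_cast
  linear_combination (Complex.cos ((xt : ℂ) - x₀)) * hR - (Complex.sin ((xt : ℂ) - x₀)) * hψ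

/-! ### The entire periodic integrand `G`: continuity, separate analyticity, periodicity -/

/-- the complex-stiffness XY Boltzmann weight
`G(z) = exp(C Σ_s [(1 − cos(z(s+e₁) − z s)) + (1 − cos(z(s+e₂) − z s)) + a − R cos(z(s+e_τ) − z s + ψ)])`
is continuous on `ℂ^Λ`. -/
theorem gaugeTwist_integrand_continuous (C a R ψ : ℂ) (L M : ℕ) [NeZero L] [NeZero M] :
    Continuous fun z : Λ L M → ℂ => Complex.exp (C * ∑ s : Λ L M,
      ((1 - Complex.cos (z (s.1 + ![1, 0], s.2) - z s)) + (1 - Complex.cos (z (s.1 + ![0, 1], s.2) - z s))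
        + a - R * Complex.cos (z (s.1, s.2 + 1) - z s + ψ))) := by
  fun_prop

/-- the complex-stiffness XY Boltzmann weight `G` is (Fréchet-)entire on `ℂ^Λ`. -/
theorem gaugeTwist_integrand_differentiable (C a R ψ : ℂ) (L M : ℕ) [NeZero L] [NeZero M] :
    Differentiable ℂ fun z : Λ L M → ℂ => Complex.exp (C * ∑ s : Λ L M,
      ((1 - Complex.cos (z (s.1 + ![1, 0], s.2) - z s)) + (1 - Complex.cos (z (s.1 + ![0, 1], s.2) - z s))
        + a - R * Complex.cos (z (s.1, s.2 + 1) - z s + ψ))) := by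
  fun_prop

/-- the complex-stiffness XY Boltzmann weight `G` is entire in each coordinate separately, at every complex
base point. -/
theorem gaugeTwist_integrand_differentiable_update (C a R ψ : ℂ) (L M : ℕ) [NeZero L] [NeZero M]
    (z : Λ L M → ℂ) (s₀ : Λ L M) :
    Differentiable ℂ fun t : ℂ => Complex.exp (C * ∑ s : Λ L M,
      ((1 - Complex.cos (Function.update z s₀ t (s.1 + ![1, 0], s.2) - Function.update z s₀ t s))
        + (1 - Complex.cos (Function.update z s₀ t (s.1 + ![0, 1], s.2) - Function.update z s₀ t s))
        + a - R * Complex.cos (Function.update z s₀ t (s.1, s.2 + 1) - Function.update z s₀ t s + ψ))) :=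
  (gaugeTwist_integrand_differentiable C a R ψ L M).comp
    (fun t => (hasDerivAt_update z s₀ t).differentiableAt)

/-- shifting one coordinate by `2π` does not change a cosine of a (shifted) coordinate difference. -/
theorem gaugeTwist_cos_update_two_pi_add {ι : Type*} [DecidableEq ι] (z : ι → ℂ) (s₀ p q : ι)
    (w : ℂ) :
    Complex.cos (Function.update z s₀ (z s₀ + 2 * Real.pi) p
        - Function.update z s₀ (z s₀ + 2 * Real.pi) q + w) = Complex.cos (z p - z q + w) := by
  rcases eq_or_ne p s₀ with hp | hp <;> rcases eq_or_ne q s₀ with hq | hq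
  · simp only [hp, hq, Function.update_self, sub_self, zero_add]
  · simp only [hp, Function.update_self, Function.update_of_ne hq]
    rw [show z s₀ + 2 * (Real.pi : ℂ) - z q + w = z s₀ - z q + w + 2 * (Real.pi : ℂ) by ring,
      Complex.cos_add_two_pi]
  · simp only [hq, Function.update_self, Function.update_of_ne hp]
    rw [show z p - (z s₀ + 2 * (Real.pi : ℂ)) + w = z p - z s₀ + w - 2 * (Real.pi : ℂ) by ring,
      Complex.cos_sub_two_pi]
  · simp only [Function.update_of_ne hp, Function.update_of_ne hq]

/-- shifting one coordinate by `2π` does not change a cosine of a coordinate difference. -/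
theorem gaugeTwist_cos_update_two_pi {ι : Type*} [DecidableEq ι] (z : ι → ℂ) (s₀ p q : ι) :
    Complex.cos (Function.update z s₀ (z s₀ + 2 * Real.pi) p
        - Function.update z s₀ (z s₀ + 2 * Real.pi) q) = Complex.cos (z p - z q) := by
  simpa only [add_zero] using gaugeTwist_cos_update_two_pi_add z s₀ p q 0

/-- the complex-stiffness XY Boltzmann weight `G` is `2π`-periodic in each coordinate separately (every
coordinate only enters through cosines of coordinate differences). -/
theorem gaugeTwist_integrand_periodic (C a R ψ : ℂ) (L M : ℕ) [NeZero L] [NeZero M]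
    (z : Λ L M → ℂ) (s₀ : Λ L M) :
    Complex.exp (C * ∑ s : Λ L M,
      ((1 - Complex.cos (Function.update z s₀ (z s₀ + 2 * Real.pi) (s.1 + ![1, 0], s.2)
          - Function.update z s₀ (z s₀ + 2 * Real.pi) s))
        + (1 - Complex.cos (Function.update z s₀ (z s₀ + 2 * Real.pi) (s.1 + ![0, 1], s.2)
          - Function.update z s₀ (z s₀ + 2 * Real.pi) s))
        + a - R * Complex.cos (Function.update z s₀ (z s₀ + 2 * Real.pi) (s.1, s.2 + 1)
          - Function.update z s₀ (z s₀ + 2 * Real.pi) s + ψ)))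
    = Complex.exp (C * ∑ s : Λ L M,
      ((1 - Complex.cos (z (s.1 + ![1, 0], s.2) - z s)) + (1 - Complex.cos (z (s.1 + ![0, 1], s.2) - z s))
        + a - R * Complex.cos (z (s.1, s.2 + 1) - z s + ψ))) := by
  simp only [gaugeTwist_cos_update_two_pi, gaugeTwist_cos_update_two_pi_add]

/-! ### STEP 2: the time-coordinate bookkeeping of the gauge shift `c(x, τ) = -τ.val • ψ` -/

/-- crossing a temporal bond `τ → τ + 1` changes the gauge shift `-τ.val • ψ` by `-ψ`, except across the
wrap bond `M - 1 → 0` where it changes by `(M - 1)ψ`; adding the per-bond twist `ψ` leaves exactly the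
boundary twist `Mψ` on the last time slice and nothing elsewhere (uniformly in `M ≥ 1`). -/
theorem gaugeTwist_shift_step (M : ℕ) [NeZero M] (τ : ZMod M) (ψ : ℂ) :
    -((((τ + 1).val : ℕ)) : ℂ) * ψ - (-(((τ.val : ℕ)) : ℂ) * ψ) + ψ =
      if τ.val = M - 1 then (M : ℂ) * ψ else 0 := by
  have hM : 0 < M := Nat.pos_of_ne_zero (NeZero.ne M)
  split_ifs with h
  · have hM1 : M - 1 + 1 = M := by omega
    have h1 : τ + 1 = 0 := by
      rw [← ZMod.natCast_zmod_val τ, h, ← Nat.cast_add_one, hM1, ZMod.natCast_self]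
    rw [h1, ZMod.val_zero, h, Nat.cast_zero, Nat.cast_pred hM]
    ring
  · have hlt : τ.val + 1 < M := by
      have := ZMod.val_lt τ
      omega
    have hone : (1 : ZMod M).val = 1 := by
      rw [ZMod.val_one_eq_one_mod]
      exact Nat.mod_eq_of_lt (by omega)
    have h2 : τ.val + (1 : ZMod M).val < M := by
      rw [hone]
      exact hlt
    rw [ZMod.val_add_of_lt h2, hone, Nat.cast_add, Nat.cast_one]
    ring

/-- STEP 2, per site: after the gauge shift `θ ↦ θ + c`, `c(x, τ) = -τ.val • ψ`, the spatial cosines are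
unchanged and the temporal term `a − R cos(∂_τθ + ψ)` becomes `a − R cos(∂_τθ + twist)` with
`twist = Mψ` on the last time slice and `0` elsewhere. -/
theorem gaugeTwist_site_shift (M : ℕ) [NeZero M] (x₁ x₂ xt x₀ : ℝ) (τ : ZMod M) (a R ψ : ℂ) :
    (1 - Complex.cos (((x₁ : ℂ) + -(((τ.val : ℕ)) : ℂ) * ψ) - ((x₀ : ℂ) + -(((τ.val : ℕ)) : ℂ) * ψ)))
      + (1 - Complex.cos (((x₂ : ℂ) + -(((τ.val : ℕ)) : ℂ) * ψ) - ((x₀ : ℂ) + -(((τ.val : ℕ)) : ℂ) * ψ)))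
      + a - R * Complex.cos (((xt : ℂ) + -((((τ + 1).val : ℕ)) : ℂ) * ψ)
          - ((x₀ : ℂ) + -(((τ.val : ℕ)) : ℂ) * ψ) + ψ)
    = (((1 - Real.cos (x₁ - x₀) : ℝ)) : ℂ) + (((1 - Real.cos (x₂ - x₀) : ℝ)) : ℂ) + a
      - R * Complex.cos (((xt - x₀ : ℝ) : ℂ) + (if τ.val = M - 1 then (M : ℂ) * ψ else 0)) := by
  have e1 : ((x₁ : ℂ) + -(((τ.val : ℕ)) : ℂ) * ψ) - ((x₀ : ℂ) + -(((τ.val : ℕ)) : ℂ) * ψ)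
      = ((x₁ - x₀ : ℝ) : ℂ) := by
    rw [Complex.ofReal_sub]; ring
  have e2 : ((x₂ : ℂ) + -(((τ.val : ℕ)) : ℂ) * ψ) - ((x₀ : ℂ) + -(((τ.val : ℕ)) : ℂ) * ψ)
      = ((x₂ - x₀ : ℝ) : ℂ) := by
    rw [Complex.ofReal_sub]; ring
  have e3 : ((xt : ℂ) + -((((τ + 1).val : ℕ)) : ℂ) * ψ) - ((x₀ : ℂ) + -(((τ.val : ℕ)) : ℂ) * ψ) + ψ
      = ((xt - x₀ : ℝ) : ℂ) + (if τ.val = M - 1 then (M : ℂ) * ψ else 0) := by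
    rw [← gaugeTwist_shift_step M τ ψ, Complex.ofReal_sub]; ring
  rw [e1, e2, e3]
  push_cast
  ring

/-! ### The registered stub -/

/-- S2a-ii of line `theta-rotor-equimodular-zeros` (registered stub signature): GAUGE REDUCTION TO A
TWISTED COMPLEX-STIFFNESS XY MODEL, given the iterated contour shift on the torus `[0,2π]^Λ` for this
`(L, M)` (exact, every `L ≥ 1`, every `M ≥ 1`).  Pointwise `a(1 − cos v) + b sin v = a − R cos(v + ψ)` for
`R cos ψ = a = 1 + iε₁`, `R sin ψ = b = iε₂` (STEP 1); then the complex shift `θ(x,τ) ↦ θ(x,τ) − τ.val • ψ`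
of the entire periodic integrand moves every per-bond twist `ψ` onto the wrap-around temporal bonds
`τ = M − 1 → 0`, which carry the total twist `Mψ` (STEP 2). -/
theorem stub_partZ_witness_gauge_of_shift : ∀ (K ε₁ ε₂ : ℝ) (L M : ℕ) [NeZero L] [NeZero M] (R ψ : ℂ), (∀ (G : (Λ L M → ℂ) → ℂ) (c : Λ L M → ℂ), Continuous G → (∀ (z : Λ L M → ℂ) (s : Λ L M), Differentiable ℂ (fun t : ℂ => G (Function.update z s t))) → (∀ (z : Λ L M → ℂ) (s : Λ L M), G (Function.update z s (z s + 2 * Real.pi)) = G z) → MeasureTheory.integral (MeasureTheory.volume.restrict (cube L M)) (fun θ => G (fun s => (θ s : ℂ) + c s)) = MeasureTheory.integral (MeasureTheory.volume.restrict (cube L M)) (fun θ => G (fun s => (θ s : ℂ)))) → R * Complex.cos ψ = 1 + Complex.I * ε₁ → R * Complex.sin ψ = Complex.I * ε₂ → partZ K (witness ε₁ ε₂) L M = MeasureTheory.integral (MeasureTheory.volume.restrict (cube L M)) (fun θ => Complex.exp (-(4 * (K : ℂ)) * ∑ s : Λ L M, ( (((1 - Real.cos (θ (s.1 + ![1, 0],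 s.2) - θ s) : ℝ)) : ℂ) + (((1 - Real.cos (θ (s.1 + ![0, 1], s.2) - θ s) : ℝ)) : ℂ) + ((1 : ℂ) + Complex.I * ε₁) - R * Complex.cos (((θ (s.1, s.2 + 1) - θ s : ℝ) : ℂ) + (if (s.2).val = M - 1 then (M : ℂ) * ψ else 0)) ))) := by
  intro K ε₁ ε₂ L M _ _ R ψ hshift hR hψ
  -- STEP 2 (contour shift of the entire periodic integrand `G` by `c(x, τ) = -τ.val • ψ`)
  have key := hshift _ (fun s => -((((s.2).val : ℕ)) : ℂ) * ψ)
    (gaugeTwist_integrand_continuous (-(4 * (K : ℂ))) ((1 : ℂ) + Complex.I * ε₁) R ψ L M)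
    (gaugeTwist_integrand_differentiable_update (-(4 * (K : ℂ))) ((1 : ℂ) + Complex.I * ε₁) R ψ L M)
    (gaugeTwist_integrand_periodic (-(4 * (K : ℂ))) ((1 : ℂ) + Complex.I * ε₁) R ψ L M)
  refine Eq.trans ?_ (key.symm.trans ?_)
  · -- STEP 1: `e^{-A(θ)} = G(θ)` on real configurations
    unfold partZ
    refine congrArg (MeasureTheory.integral _) (funext fun θ => ?_)
    rw [gaugeTwist_action_witness, neg_mul]
    congr 1
    congr 1
    congr 1
    exact Finset.sum_congr rfl fun s _ => gaugeTwist_site_gauge _ _ _ _ ε₁ ε₂ R ψ hR hψ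
  · -- the shifted integrand is the twisted Boltzmann weight
    refine congrArg (MeasureTheory.integral _) (funext fun θ => ?_)
    dsimp only
    congr 1
    congr 1
    exact Finset.sum_congr rfl fun s _ =>
      gaugeTwist_site_shift M _ _ _ _ s.2 ((1 : ℂ) + Complex.I * ε₁) R ψ

end

end Summit.HubbardSuperconductivity.BirComplexStableXYNegative
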